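import Summits.Langlands.Langlands.Theses.AnalyticDescent
import Summits.Langlands.Langlands.Theorems.IrreducibilityBySelfDualityPairLBoundaryJSStandardEntire
import Summits.Langlands.Langlands.Theorems.IrreducibilityBySelfDualityPairLBoundaryJSSsv
import Literature.NumberTheory.Automorphic.PairLFunctionPolesRepDataRankNeGodementJacquet
import Literature.NumberTheory.Automorphic.PairLFunctionPolesRepDataHolds
import Literature.NumberTheory.Automorphic.SatakeParameterGenericBoundHolds
import Literature.NumberTheory.Automorphic.SatakeParameterBoundHolds

/-!
# Line `rankone` — skeleton for the crux `PairLBoundaryJS` (stmt-Langlands-13622), crux-strategist s2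

ALTERNATIVE line (`--alt` semantics: it never touches the lead's line `Sketch` nor s1's `halves`), and at the
same time the PROVED GLUE of the strategist's DECOMPOSITION of the crux BY PARTNER RANK:

  `PairLBoundaryJS ⇐ PairLBoundaryJSRankOnePartner ∧ PairLBoundaryJSHigherRank`   (`PairLBoundaryJS_of_subs`, no sorry)
  `PairLBoundaryJSRankOnePartner ⇐ StandardLNonvanishingLine`                    (`rankOnePartner_of_js1976`, no sorry)

Conclusion decl: `Summit.Langlands.Langlands.Theses.AnalyticDescent.PairLBoundaryJS` (one of the six route aliases of
item stmt-Langlands-13622; all six have the same text, `Iff.rfl` with the Literature fact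
`JacquetShalika1981_partialPairL_boundary_repData`, see `partialPairL_boundary_repData_of_subs`).

## Idea
CONSUMPTION AUDIT (census F1): every consumer of Arthur–Clozel (2.2) in the tree instantiates it at a RANK-ONE PARTNER —
`BockleHuiIrreducibleGL3AnalyticProofs` (`hJ2 3 1`, `hJ2 1 1`, `hJ2 3 1`, all at `s₀ = 1`; the only route whose `closes`
takes the crux, `IrreducibilityBySelfDuality`, consumes it through this file), `HilbertModularGaloisRepAnalyticProofs`
(`2 1`, `2 1`), `RamakrishnanMultiplicityOneLemma414` (`3 1`), `SelfdualGL3AdjointLiftProofs` (`3 1`, `3 1`, `1 1`),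
`HeckeCharacterPairRigidity` / `BockleHui…NoContragredient` (`1 1`). Nobody instantiates `(n, m)` with both ranks `≥ 2`.

The rank-one-partner slice has a DIFFERENT and SMALLER engine than the rest of the crux:

* its Jacquet–Shalika half is Godement–Jacquet, a THEOREM of the tree (`hasEntireContinuation_partialStandardL_of_ssv
  Ssv.stub_ssv`), and
* its Shahidi half is Jacquet–Shalika, Invent. Math. 38 (1976): `L_S(1 + it, Π) ≠ 0` for cuspidal `Π` on `GL_n`,
  whose engine is the Eisenstein series on `GL_{n+1}` induced from the maximal parabolic `P_{n,1}` — the ONE parabolic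
  for which Schwartz (Godement) sections exist: `E*(g; φ, Φ, s) = |det g|^{a s} ∫_{GL_n(K)\GL_n(𝔸)} φ(h) |det h|^{-b s}
  ∑_{ξ ∈ M_{n,n+1}(K), rk ξ = n} Φ(h⁻¹ ξ g) dh = L^S(·, Π̃) · E(flat section)`. Its continuation is ENTIRE by the
  Godement–Jacquet theta machinery on `M_{n,n+1}` (singular strata vanish by cuspidality; templates
  `GodementJacquetThetaSeries / SingularOrbitVanishing / SingularUnfolding / Reflection / DualTerm`), its two constant
  terms (`P_{n,1}`, `P_{1,n}`: non-self-associate for `n ≥ 2`) give the maximal-parabolic Maass–Selberg relation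
  (template: `FuchsianEisensteinTruncation* / TruncationPairings / Holomorphy`), positivity of `‖Λ^T E‖²` forbids poles of
  the flat series on the unitary axis, and its `ψ`-Whittaker coefficient is `R_S(s) / L^S(1 + b s, Π × χ̄)`
  (Casselman–Shalika at unramified places: `ShintaniWhittakerFormula`, `WhittakerSphericalNonvanishing`; at the places of
  `S` the Jacquet integral over the ABELIAN radical `N_P ≅ F_vⁿ` of a section with `Φ_v = Φ₁ ⊗ Φ₂`, `Φ₁ ∈ C_c^∞(GL_n(F_v))`,
  `Φ̂₂ ∈ C_c^∞`, is the Fourier transform of a `C_c^∞` function: entire and non-zero at the point — archimedean places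
  included). NO archimedean Rankin–Selberg integral, NO Whittaker asymptotics, NO `HumphriesJo2024_archRankinSelberg_testVector`.
  (Shahidi, BAMS 2 (1980), pp. 462–464, held `paper:doi-10-1090-s0273-0979-1980-14769-2`, is the same scheme on
  `GL_{n+m} ⊃ P_{n,m}`, but there Schwartz sections do not exist and the continuation/unitary-axis holomorphy is Langlands,
  LNM 544 — which is why the general crux does not transfer and stays in `PairLBoundaryJSHigherRank`.)

So this line cuts the crux on its own binder telescope into

* `stub_js1976` — **the standard statement's non-vanishing half** `StandardLNonvanishingLine`: for cuspidal `Q` on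
  `GL_n(𝔸_F)`, `n ≥ 2` (every automorphic measure `μ`), every finite `S`, every honest Satake family `γ` of `Q` off `S` and
  every `s₀` with `Re s₀ = 1`: if `L^S(s, γ) → c` as `s → s₀` inside `Re s > 1` then `c ≠ 0`. EXACTLY the hypothesis `hNV`
  of the tree's `…_rank_ne_one_of_godementJacquet` (D-0026: explicit hypothesis, no named fact). Size XL−, soft.
* `stub_higher_rank` — **the crux at ranks `n, m ≥ 2`** `PairLBoundaryJSHigherRank` (verbatim telescope with two extra
  hypotheses `2 ≤ n`, `2 ≤ m`): NOT claimed easier — it is what the lead's line `Sketch` (whose composition proves all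
  ranks) and s1's `halves` serve; it is here so that the composition concludes the crux BY NAME.

Composition `PairLBoundaryJS_of : StandardLNonvanishingLine → PairLBoundaryJSHigherRank → PairLBoundaryJS` is PROVED
below (no sorry outside the two stubs): case split on `n, m ∈ {1} ∪ [2, ∞)`; `(1,1)` is the tree's theorem
`JacquetShalika1981_partialPairL_boundary_repData_one_one`; `(n,1)` / `(1,n)` are the tree's one-family reductions
(`exists_one_family_datum_of_standard(_at)(_left)`, `…_boundary_of_ne_one_of_one_family_of_le_two(')`,
`…_at_one_of_rank_ne_of_summable_of_normLt`, `JacquetShalika1981_partialPairL_boundary_repData_rank_ne`) fed with the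
standard statement `standard_at_of_js1976` = (Godement–Jacquet finiteness, THEOREM via ssv) ∧ `stub_js1976`, with
(5.3.3) `summable_normSq_trace_satakePow_holds` and Cor. (2.5) `JacquetShalika1981_norm_lt_sqrt_of_isGeneric_holds`
(both THEOREMS).

Disproof used (`Cruxes/PairLBoundaryJS/Disproof.lean`, cdisprove cycle 1 closed, no kill, no `-- Targets`; landed
`Theorems/PairLBoundaryJS/Negative/LoadBearing.lean`): `pairLBoundaryJS_false_without_X` — `¬X` lives in `stub_higher_rank`
(equal rank `≥ 2`) and in the `(1,1)` THEOREM; at unequal rank `X` is empty; `stub_js1976` has no `X` (standard `L` of a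
cusp form of rank `≥ 2` has no pole on `Re s = 1`). `pairLBoundaryJS_false_without_satakeLink` — every statement keeps the
honest links (`IsSatakeFamilyOf Q S γ` in `stub_js1976`; `HasSatakeParamAt` in `stub_higher_rank`); the Liouville family is
not a Satake family of a cusp form. No stub is an instance refuted by a landed Negative lemma (both are theorems in print:
Jacquet–Shalika 1976, Theorem p. 1; JS II Prop. 3.6 + Shahidi 1981 Thm. 5.1).
-/

noncomputable section

-- `Summit.Langlands.Langlands.…` (summit = sub-problem name, D-0017 layout) trips `dupNamespace`
set_option linter.dupNamespace false

open scoped Topology Classical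
open NumberField IsDedekindDomain MeasureTheory Filter
open Literature.NumberTheory.Automorphic AdelicGroupData
open Summit.Langlands.Langlands.Theorems

-- Mathlib idiom; needed to mention Borel–Jacquet data, as in `PairLFunctionPolesRepData`
attribute [local instance 100] LieRing.ofAssociativeRing

namespace Summit.Langlands.Langlands.Cruxes.PairLBoundaryJS.RankOne

/-! ## The two sub-cruxes (texts of `children.json`) -/

/-- **Sub-crux 1 — Jacquet–Shalika (1976): the boundary values of the partial standard `L`-functions of cuspidal
`GL_n`, `n ≥ 2`, on `Re s = 1` are non-zero** (limit form; `hNV` of `PairLFunctionPolesRepDataRankNeGodementJacquet`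
quantified over the rank, the field and the automorphic measure). [cite: JacquetShalikaInvent1976, Theorem p. 1] -/
def StandardLNonvanishingLine : Prop :=
  ∀ (n : ℕ) (F : Type) [Field F] [NumberField F], 2 ≤ n →
    ∀ (μ : MeasureTheory.Measure (Literature.NumberTheory.Automorphic.AdelicGroupData.gl n F).automorphicQuotient)
      [(Literature.NumberTheory.Automorphic.AdelicGroupData.gl n F).IsAutomorphicMeasure μ] {s₀ : ℂ}, s₀.re = 1 →
      ∀ (Q : Literature.NumberTheory.Automorphic.CuspidalAutomorphicRepGL n F μ)
        {S : Set (IsDedekindDomain.HeightOneSpectrum (NumberField.RingOfIntegers F))}, S.Finite →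
        ∀ {γ : IsDedekindDomain.HeightOneSpectrum (NumberField.RingOfIntegers F) → Multiset ℂ},
          Literature.NumberTheory.Automorphic.IsSatakeFamilyOf Q S γ →
          ∀ {c : ℂ}, Tendsto (Literature.NumberTheory.Automorphic.partialStandardL S γ) (𝓝[{s : ℂ | 1 < s.re}] s₀) (𝓝 c) →
            c ≠ 0

/-- **Sub-crux 2 — the crux at ranks `n, m ≥ 2`**: the telescope of `PairLBoundaryJS` verbatim with the two extra
hypotheses `2 ≤ n`, `2 ≤ m`. [cite: ArthurClozelAMS120, Ch. 3 §2 (2.2), p. 171] [cite: JacquetShalikaAJM1981II, Prop. 3.6]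
[cite: ShahidiAJM1981, Thm. 5.1] -/
def PairLBoundaryJSHigherRank : Prop :=
  ∀ (n m : ℕ) (F : Type) [Field F] [NumberField F] (hF : Literature.NumberTheory.Automorphic.isCompact_glFiniteIntegralLevel n F) (hF' : Literature.NumberTheory.Automorphic.isCompact_glFiniteIntegralLevel m F), 0 < n → 0 < m → 2 ≤ n → 2 ≤ m → ∀ (π : Literature.NumberTheory.Automorphic.CuspidalAutomorphicRepData n F hF) (π' : Literature.NumberTheory.Automorphic.CuspidalAutomorphicRepData m F hF'), ∃ S₀ : Set (IsDedekindDomain.HeightOneSpectrum (NumberField.RingOfIntegers F)), S₀.Finite ∧ ∀ {S : Set (IsDedekindDomain.HeightOneSpectrum (NumberField.RingOfIntegers F))}, S.Finite → S₀ ⊆ S → ∀ {α β : IsDedekindDomain.HeightOneSpectrum (NumberField.RingOfIntegers F) → Multiset ℂ}, (∀ w ∉ S, π.1.HasSatakeParamAt w (α w)) → (∀ w ∉ S, π'.1.HasSatakeParamAt w (β w)) → (∀ w ∉ S, ‖(α w).prod‖ = 1) → (∀ w ∉ S, ‖(β w).prod‖ = 1) → ∀ {s₀ : ℂ}, s₀.re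 = 1 → ¬ (n = m ∧ ∀ᶠ w in cofinite, (α w).map ((((w.residueCard : ℂ) ^ (1 - s₀))) * ·) = (β w).map (·⁻¹)) → ∃ c : ℂ, c ≠ 0 ∧ Tendsto (fun s : ℂ => ∏' w : {w : IsDedekindDomain.HeightOneSpectrum (NumberField.RingOfIntegers F) // w ∉ S}, ((Literature.NumberTheory.Automorphic.satakePairPolynomial (α w.1) (β w.1)).eval ((w.1.residueCard : ℂ) ^ (-s)))⁻¹) (𝓝[{s : ℂ | 1 < s.re}] s₀) (𝓝 c)

/-- **The rank-one-partner slice of the crux** (what every consumer instantiates): the telescope of `PairLBoundaryJS`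
verbatim with the extra hypothesis `n = 1 ∨ m = 1`. Not a stub: PROVED below from `StandardLNonvanishingLine`
(`rankOnePartner_of_js1976`). [cite: ArthurClozelAMS120, Ch. 3 §2 (2.2), p. 171] -/
def PairLBoundaryJSRankOnePartner : Prop :=
  ∀ (n m : ℕ) (F : Type) [Field F] [NumberField F] (hF : Literature.NumberTheory.Automorphic.isCompact_glFiniteIntegralLevel n F) (hF' : Literature.NumberTheory.Automorphic.isCompact_glFiniteIntegralLevel m F), 0 < n → 0 < m → (n = 1 ∨ m = 1) → ∀ (π : Literature.NumberTheory.Automorphic.CuspidalAutomorphicRepData n F hF) (π' : Literature.NumberTheory.Automorphic.CuspidalAutomorphicRepData m F hF'), ∃ S₀ : Set (IsDedekindDomain.HeightOneSpectrum (NumberField.RingOfIntegers F)), S₀.Finite ∧ ∀ {S : Set (IsDedekindDomain.HeightOneSpectrum (NumberField.RingOfIntegers F))}, S.Finite → S₀ ⊆ S → ∀ {α β : IsDedekindDomain.HeightOneSpectrum (NumberField.RingOfIntegers F) → Multiset ℂ}, (∀ w ∉ S, π.1.HasSatakeParamAt w (α w)) → (∀ w ∉ S, π'.1.HasSatakeParamAt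 w (β w)) → (∀ w ∉ S, ‖(α w).prod‖ = 1) → (∀ w ∉ S, ‖(β w).prod‖ = 1) → ∀ {s₀ : ℂ}, s₀.re = 1 → ¬ (n = m ∧ ∀ᶠ w in cofinite, (α w).map ((((w.residueCard : ℂ) ^ (1 - s₀))) * ·) = (β w).map (·⁻¹)) → ∃ c : ℂ, c ≠ 0 ∧ Tendsto (fun s : ℂ => ∏' w : {w : IsDedekindDomain.HeightOneSpectrum (NumberField.RingOfIntegers F) // w ∉ S}, ((Literature.NumberTheory.Automorphic.satakePairPolynomial (α w.1) (β w.1)).eval ((w.1.residueCard : ℂ) ^ (-s)))⁻¹) (𝓝[{s : ℂ | 1 < s.re}] s₀) (𝓝 c)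

/-! ## Registered stubs -/

/-- **STUB (XL−, soft) — Jacquet–Shalika (1976), Theorem p. 1: `L_S(1 + it, Π) ≠ 0`** for cuspidal `Π` on
`GL_n(𝔸_F)`, `n ≥ 2`, in the tree's limit form. Engine: the Schwartz-section Eisenstein series on `GL_{n+1} ⊃ P_{n,1}`
(entire by the Godement–Jacquet theta machinery on `M_{n,n+1}`; two constant terms; maximal-parabolic Maass–Selberg;
unitary-axis holomorphy of the flat series by positivity of `‖Λ^T E‖²`; Whittaker coefficient `R_S(s)/L^S(1 + b s, Π × χ̄)`
by Casselman–Shalika; local sections with compactly supported Fourier data). No archimedean Rankin–Selberg theory. -/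
theorem stub_js1976 : StandardLNonvanishingLine := by
  sorry

/-- **STUB (XL) — the crux at ranks `n, m ≥ 2`** (Jacquet–Shalika II Prop. 3.6 + Shahidi 1981 Thm. 5.1 for pairs with both
ranks at least two). Served by the lead's line `Sketch` (Mœglin–Waldspurger continuation + Landau; open archimedean facts
`HumphriesJo2024_archRankinSelberg_testVector`, `JacquetShalika1990_archRankinSelbergGap_entireRatio`) or by `halves`
(`stub_sh_half` via Langlands' Eisenstein series on `GL_{n+m}`); NOT claimed easier than the crux at these ranks. -/
theorem stub_higher_rank : PairLBoundaryJSHigherRank := by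
  sorry

/-! ## Proved glue -/

section Standard

variable {n : ℕ} {F : Type} [Field F] [NumberField F]

/-- **The standard statement at every point of `Re s = 1` from Godement–Jacquet (a THEOREM of the tree, via the
simultaneous spherical vector) and `StandardLNonvanishingLine`**: for cuspidal `Q` on `GL_n(𝔸_F)`, `n ≥ 2`, every
finite `S`, every honest Satake family `γ` off `S` and every `s₀` with `Re s₀ = 1`, `L^S(s, γ) → c ≠ 0` as `s → s₀`,
`Re s > 1`. The limit EXISTS by `hasEntireContinuation_partialStandardL_of_ssv Ssv.stub_ssv` (entire continuation);
it is non-zero by the hypothesis. [cite: GodementJacquet1972, Thm. 13.8] [cite: JacquetShalikaInvent1976, Theorem p. 1] -/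
theorem standard_at_of_js1976 (h76 : StandardLNonvanishingLine) (hn : 2 ≤ n)
    (μ : Measure (gl n F).automorphicQuotient) [(gl n F).IsAutomorphicMeasure μ] {s₀ : ℂ} (hs₀ : s₀.re = 1) :
    ∀ (Q : CuspidalAutomorphicRepGL n F μ) {S : Set (HeightOneSpectrum (𝓞 F))} (_hS : S.Finite)
      {γ : SatakeFamily F} (_hγ : IsSatakeFamilyOf Q S γ),
      ∃ c : ℂ, c ≠ 0 ∧ Tendsto (partialStandardL S γ) (𝓝[{s : ℂ | 1 < s.re}] s₀) (𝓝 c) := by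
  intro Q S hS γ hγ
  obtain ⟨g, hg, hgL⟩ := hasEntireContinuation_partialStandardL_of_ssv Ssv.stub_ssv hn Q hS hγ
  have hgc : Tendsto g (𝓝[{s : ℂ | 1 < s.re}] s₀) (𝓝 (g s₀)) :=
    (hg.continuous.tendsto s₀).mono_left nhdsWithin_le_nhds
  have hlim : Tendsto (partialStandardL S γ) (𝓝[{s : ℂ | 1 < s.re}] s₀) (𝓝 (g s₀)) := by
    refine hgc.congr' ?_
    filter_upwards [self_mem_nhdsWithin] with s hs
    exact hgL s hs
  exact ⟨g s₀, h76 n F hn μ hs₀ Q hS hγ hlim, hlim⟩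

/-- **Arthur–Clozel (2.2) for Borel–Jacquet data on `GL_n × GL_1`, `n ≥ 2`**, from `StandardLNonvanishingLine`: the
tree's `JacquetShalika1981_partialPairL_boundary_repData_rank_ne` at `(n, 1)` fed with the one-family data of the
standard statement (`exists_one_family_datum_of_standard(_at)`), (5.3.3) `summable_normSq_trace_satakePow_holds` and
Cor. (2.5) `JacquetShalika1981_norm_lt_sqrt_of_isGeneric_holds` (theorems). [cite: ArthurClozelAMS120, Ch. 3 §2 (2.2)] -/
theorem boundary_repData_rank_one_right_of_js1976 (h76 : StandardLNonvanishingLine) (hn : 2 ≤ n)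
    (hF : isCompact_glFiniteIntegralLevel n F) (hF' : isCompact_glFiniteIntegralLevel 1 F)
    (π : CuspidalAutomorphicRepData n F hF) (χ : CuspidalAutomorphicRepData 1 F hF') :
    ∃ S₀ : Set (HeightOneSpectrum (𝓞 F)), S₀.Finite ∧
      ∀ {S : Set (HeightOneSpectrum (𝓞 F))} (_hS : S.Finite) (_hS₀ : S₀ ⊆ S)
        {α β : SatakeFamily F} (_hα : ∀ w ∉ S, π.1.HasSatakeParamAt w (α w))
        (_hβ : ∀ w ∉ S, χ.1.HasSatakeParamAt w (β w))
        (_hu : ∀ w ∉ S, ‖(α w).prod‖ = 1) (_hu' : ∀ w ∉ S, ‖(β w).prod‖ = 1)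
        {s₀ : ℂ} (_hs₀ : s₀.re = 1),
        ∃ c : ℂ, c ≠ 0 ∧ Tendsto (partialPairL S α β) (𝓝[{s : ℂ | 1 < s.re}] s₀) (𝓝 c) :=
  JacquetShalika1981_partialPairL_boundary_repData_rank_ne (by omega)
    (fun μ _ μ' _ =>
      JacquetShalika1981_partialPairL_at_one_of_rank_ne_of_summable_of_normLt (μ' := μ')
        (summable_normSq_trace_satakePow_holds (n := n) (K := F) (μ := μ))
        (summable_normSq_trace_satakePow_of_le_one le_rfl)
        (fun _ _ _ _ _ => JacquetShalika1981_norm_lt_sqrt_of_isGeneric_holds)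
        fun _ _ _ P P' => exists_one_family_datum_of_standard
          (standard_at_of_js1976 h76 hn μ Complex.one_re) P P')
    (fun μ _ μ' _ =>
      JacquetShalika1981_partialPairL_boundary_of_ne_one_of_one_family_of_le_two' (μ := μ) (μ' := μ') (by norm_num)
        fun _ _ P P' _ hs₀ _ => exists_one_family_datum_of_standard_at
          (standard_at_of_js1976 h76 hn μ hs₀) P P')
    hF hF' (by omega) one_pos π χ

/-- **Arthur–Clozel (2.2) for Borel–Jacquet data on `GL_1 × GL_n`, `n ≥ 2`**, symmetrically (the `_left` one-family
data; every input at `GL_1` is a theorem). [cite: ArthurClozelAMS120, Ch. 3 §2 (2.2)] -/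
theorem boundary_repData_rank_one_left_of_js1976 (h76 : StandardLNonvanishingLine) (hn : 2 ≤ n)
    (hF' : isCompact_glFiniteIntegralLevel 1 F) (hF : isCompact_glFiniteIntegralLevel n F)
    (χ : CuspidalAutomorphicRepData 1 F hF') (π : CuspidalAutomorphicRepData n F hF) :
    ∃ S₀ : Set (HeightOneSpectrum (𝓞 F)), S₀.Finite ∧
      ∀ {S : Set (HeightOneSpectrum (𝓞 F))} (_hS : S.Finite) (_hS₀ : S₀ ⊆ S)
        {β α : SatakeFamily F} (_hβ : ∀ w ∉ S, χ.1.HasSatakeParamAt w (β w))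
        (_hα : ∀ w ∉ S, π.1.HasSatakeParamAt w (α w))
        (_hu' : ∀ w ∉ S, ‖(β w).prod‖ = 1) (_hu : ∀ w ∉ S, ‖(α w).prod‖ = 1)
        {s₀ : ℂ} (_hs₀ : s₀.re = 1),
        ∃ c : ℂ, c ≠ 0 ∧ Tendsto (partialPairL S β α) (𝓝[{s : ℂ | 1 < s.re}] s₀) (𝓝 c) :=
  JacquetShalika1981_partialPairL_boundary_repData_rank_ne (by omega)
    (fun μ₁ _ μ _ =>
      JacquetShalika1981_partialPairL_at_one_of_rank_ne_of_summable_of_normLt (μ := μ₁) (μ' := μ)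
        (summable_normSq_trace_satakePow_of_le_one le_rfl)
        (summable_normSq_trace_satakePow_holds (n := n) (K := F) (μ := μ))
        (fun _ _ _ _ ρ => JacquetShalika1981_norm_lt_sqrt_of_isGeneric_of_le_one le_rfl ρ)
        fun _ _ _ P' P => exists_one_family_datum_of_standard_left
          (standard_at_of_js1976 h76 hn μ Complex.one_re) P' P)
    (fun μ₁ _ μ _ =>
      JacquetShalika1981_partialPairL_boundary_of_ne_one_of_one_family_of_le_two (μ := μ₁) (μ' := μ) (by norm_num)
        fun _ _ P' P _ hs₀ _ => exists_one_family_datum_of_standard_at_left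
          (standard_at_of_js1976 h76 hn μ hs₀) P' P)
    hF' hF one_pos (by omega) χ π

end Standard

/-- **The rank-one-partner slice of the crux from `StandardLNonvanishingLine`** (what every consumer uses): `(1,1)` is the
tree's theorem `JacquetShalika1981_partialPairL_boundary_repData_one_one`; `(n,1)` and `(1,n)`, `n ≥ 2`, are
`boundary_repData_rank_one_right/left_of_js1976`. [cite: ArthurClozelAMS120, Ch. 3 §2 (2.2)] -/
theorem rankOnePartner_of_js1976 (h76 : StandardLNonvanishingLine) : PairLBoundaryJSRankOnePartner := by
  intro n m F _ _ hF hF' hn hm h1 π π'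
  rcases Nat.lt_or_ge n 2 with hn2 | hn2
  · obtain rfl : n = 1 := by omega
    rcases Nat.lt_or_ge m 2 with hm2 | hm2
    · obtain rfl : m = 1 := by omega
      exact JacquetShalika1981_partialPairL_boundary_repData_one_one hF hF' π π'
    · obtain ⟨S₀, hS₀, h⟩ := boundary_repData_rank_one_left_of_js1976 h76 hm2 hF hF' π π'
      refine ⟨S₀, hS₀, ?_⟩
      intro S hS hsub α β hα hβ hu hu' s₀ hs₀ _hX
      exact h hS hsub hα hβ hu hu' hs₀
  · rcases Nat.lt_or_ge m 2 with hm2 | hm2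
    · obtain rfl : m = 1 := by omega
      obtain ⟨S₀, hS₀, h⟩ := boundary_repData_rank_one_right_of_js1976 h76 hn2 hF hF' π π'
      refine ⟨S₀, hS₀, ?_⟩
      intro S hS hsub α β hα hβ hu hu' s₀ hs₀ _hX
      exact h hS hsub hα hβ hu hu' hs₀
    · exfalso
      omega

/-- **GLUE of the route-level decomposition (PROVED): the crux from its two SLICES** `PairLBoundaryJSRankOnePartner`
(`min(n,m) = 1`) and `PairLBoundaryJSHigherRank` (`n, m ≥ 2`) — a case split on the ranks (trivial seam; the content of
the split is that the two slices have different engines). This is the glue item `PairLBoundaryJS_of_subs` of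
`route edit --split PairLBoundaryJS --into children.json` (children = the two slices, both in the parent's own vocabulary).
[cite: ArthurClozelAMS120, Ch. 3 §2 (2.2)] -/
theorem PairLBoundaryJS_of_subs (h1 : PairLBoundaryJSRankOnePartner) (hhr : PairLBoundaryJSHigherRank) :
    Summit.Langlands.Langlands.Theses.AnalyticDescent.PairLBoundaryJS := by
  intro n m F _ _ hF hF' hn hm π π'
  by_cases h : n = 1 ∨ m = 1
  · exact h1 n m F hF hF' hn hm h π π'
  · obtain ⟨hn1, hm1⟩ : n ≠ 1 ∧ m ≠ 1 := not_or.mp h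
    exact hhr n m F hF hF' hn hm (by omega) (by omega) π π'

/-- **The crux from `StandardLNonvanishingLine` and the higher-rank slice** (the LINE's glue: the rank-one-partner
slice is `rankOnePartner_of_js1976`). [cite: ArthurClozelAMS120, Ch. 3 §2 (2.2)] -/
theorem PairLBoundaryJS_of_js1976_of_higherRank (h76 : StandardLNonvanishingLine) (hhr : PairLBoundaryJSHigherRank) :
    Summit.Langlands.Langlands.Theses.AnalyticDescent.PairLBoundaryJS :=
  PairLBoundaryJS_of_subs (rankOnePartner_of_js1976 h76) hhr

/-! ## Composition -/

/-- **The crux from the stubs' statements** (skeleton composition, concludes the crux BY NAME). -/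
theorem PairLBoundaryJS_of :
    StandardLNonvanishingLine → PairLBoundaryJSHigherRank →
      Summit.Langlands.Langlands.Theses.AnalyticDescent.PairLBoundaryJS :=
  PairLBoundaryJS_of_js1976_of_higherRank

/-- The composition instantiated at the stubs (sanity: the skeleton closes the crux by name). -/
theorem PairLBoundaryJS_of_stubs : Summit.Langlands.Langlands.Theses.AnalyticDescent.PairLBoundaryJS :=
  PairLBoundaryJS_of stub_js1976 stub_higher_rank

/-- Route-agnostic form: the two sub-cruxes give the Literature named fact
`JacquetShalika1981_partialPairL_boundary_repData` (definitionally every route's `PairLBoundaryJS`). -/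
theorem partialPairL_boundary_repData_of_subs (h76 : StandardLNonvanishingLine) (hhr : PairLBoundaryJSHigherRank) :
    JacquetShalika1981_partialPairL_boundary_repData :=
  (show Summit.Langlands.Langlands.Theses.AnalyticDescent.PairLBoundaryJS ↔
      JacquetShalika1981_partialPairL_boundary_repData from Iff.rfl).mp (PairLBoundaryJS_of_js1976_of_higherRank h76 hhr)

/-- The rank-one-partner slice ALONE already gives what `IrreducibilityBySelfDuality`'s cone instantiates: the named fact
at `(n, 1)` for every `n ≥ 1` (sanity of the consumption audit; `hJ2 3 1`, `hJ2 1 1` of `BockleHuiIrreducibleGL3AnalyticProofs`). -/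
theorem boundary_repData_rank_one_right (h76 : StandardLNonvanishingLine) (n : ℕ) (F : Type) [Field F] [NumberField F]
    (hF : isCompact_glFiniteIntegralLevel n F) (hF' : isCompact_glFiniteIntegralLevel 1 F) (hn : 0 < n)
    (π : CuspidalAutomorphicRepData n F hF) (χ : CuspidalAutomorphicRepData 1 F hF') :
    ∃ S₀ : Set (HeightOneSpectrum (𝓞 F)), S₀.Finite ∧
      ∀ {S : Set (HeightOneSpectrum (𝓞 F))} (_hS : S.Finite) (_hS₀ : S₀ ⊆ S)
        {α β : SatakeFamily F} (_hα : ∀ w ∉ S, π.1.HasSatakeParamAt w (α w))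
        (_hβ : ∀ w ∉ S, χ.1.HasSatakeParamAt w (β w))
        (_hu : ∀ w ∉ S, ‖(α w).prod‖ = 1) (_hu' : ∀ w ∉ S, ‖(β w).prod‖ = 1)
        {s₀ : ℂ} (_hs₀ : s₀.re = 1)
        (_hX : ¬ (n = 1 ∧ ∀ᶠ w in cofinite,
          (α w).map (((w.residueCard : ℂ) ^ (1 - s₀)) * ·) = (β w).map (·⁻¹))),
        ∃ c : ℂ, c ≠ 0 ∧ Tendsto (partialPairL S α β) (𝓝[{s : ℂ | 1 < s.re}] s₀) (𝓝 c) :=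
  rankOnePartner_of_js1976 h76 n 1 F hF hF' hn one_pos (Or.inr rfl) π χ

end Summit.Langlands.Langlands.Cruxes.PairLBoundaryJS.RankOne

end
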